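import Summits.ABC.Harvest.GlueGoldfeldSzpiroNamed
import Literature.NumberTheory.EllipticCurves.PeriodAndTamagawaDiscriminantBounds
import HarnessLib

/-!
# ABC harvest — glue G-20 with its printed inputs cited BY NAME (Literature) and the Tamagawa
# input DISCHARGED

`Summits/ABC/Harvest/GlueGoldfeldSzpiroLit.lean` — cell `abc-harv`, seat abc-harv-lit-2 (KEY
LIT-GS-INPUTS), namespace `Summit.ABC.Harvest`. PROOF-ONLY companion (no `def`, no `sorry`, no new
axiom) of `GlueGoldfeldSzpiro.lean` (p552521) and `GlueGoldfeldSzpiroNamed.lean` (p554286): the two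
corollaries of the latter are restated with

* `hP` (period–discriminant, `Ω(E)·|Δ_min(E)|^{1/12} ≤ c₃`) supplied from the NAMED Literature fact
  `Literature.NumberTheory.EllipticCurves.realPeriod_mul_rpow_discriminant_le`
  ([GoldfeldSzpiro1995, p. 75 last display – p. 76 l. 1–4]; real-period form, see that file's
  faithfulness note) through its proved corollary
  `realPeriodRat_mul_rpow_minimalDiscriminantNorm_le`;
* `hTam` (`∏ c_p ≤ c₅|Δ_min|^δ`) NO LONGER A HYPOTHESIS: it is the tree THEOREM
  `Literature.NumberTheory.EllipticCurves.exists_tamagawaProduct_le_mul_rpow` (de Weger 1998,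
  Thm 3, discharged from Kodaira–Néron in `PeriodAndTamagawaDiscriminantBounds.lean`), for every
  `δ > 0` — hence `δ` is now any real in `(0, 1/12)`;
* `hT`, the TWIST STEP, kept INLINE exactly as in p554286: its analytic core ("for some twist `χ` with
  `q ≤ N²`, `L_E(1,χ) ≫ 1`", [GoldfeldSzpiro1995, p. 76], from a Rankin–Selberg mean value "as in
  [9, 5]") is asserted without proof in print (also [Goldfeld1990ModularElliptic, p. 165],
  [deWeger1998, (4) p. 110]) and is therefore not a Literature fact.

Ledger label for G-20 after this file: PROVED-MOD-FACTS with inputs — conjectural: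
`GoldfeldSzpiroBound` (the door, open), `RankZeroBSDLowerShaBound` (rank-`0` BSD lower-`Ш` half);
printed theorems as NAMED undischarged facts: bsd.S17 `rank_eq_analyticRank_of_analyticRank_le_one`
(Gross–Zagier–Kolyvagin), `realPeriod_mul_rpow_discriminant_le` (period–discriminant); printed CLAIM
inline: the twist step `hT`; discharged: the Tamagawa bound. HONESTY: abc is not proved by any of
this; A-PS is NOT abc — «NOT abc — POLY-SZPIRO(E ≈ 18)»; «never GS ⟹ A-PS proved»; typed ≠ proved.
-/

noncomputable section

open Literature.NumberTheory.EllipticCurves WeierstrassCurve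

namespace Summit.ABC.Harvest

/-- **G-20, GS's parameters, inputs by name** (`q ≤ c₈N²`, `L(E′,1) ≥ c₂`, `Ω′ ≤ c₇q^{-1/2}Ω`):
`GoldfeldSzpiroBound` + bsd.S17 + `RankZeroBSDLowerShaBound` + the Literature fact
`realPeriod_mul_rpow_discriminant_le` + (inline) the twist step ⟹
`PolySzpiroRatEff (12(3/2 + 5ε + 12δ)/(1 − 12δ)) C` for every `ε > 0`, `0 < δ < 1/12` (`→ 18`),
hence `PolySzpiroRat`; the Tamagawa input of p554286 is discharged
(`exists_tamagawaProduct_le_mul_rpow`). NOT abc — POLY-SZPIRO(E ≈ 18); conditional as stated.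
[cite: GoldfeldSzpiro1995, Thm 2 (p. 75), proof pp. 75–77] -/
theorem polySzpiroRat_of_goldfeldSzpiroBound_lit
    {ε δ c₁ c₂ c₆ c₇ c₈ : ℝ}
    (hε : 0 < ε) (hδ : 0 < δ) (hδ' : 12 * δ < 1)
    (hc₁ : 0 < c₁) (hc₂ : 0 < c₂) (hc₆ : 0 < c₆) (hc₇ : 0 < c₇) (hc₈ : 0 < c₈)
    (hGS : GoldfeldSzpiroBound)
    (hGZK : rank_eq_analyticRank_of_analyticRank_le_one)
    (hC : RankZeroBSDLowerShaBound)
    (hP : realPeriod_mul_rpow_discriminant_le)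
    (hT : ∀ (W : WeierstrassCurve ℚ) [W.IsElliptic] [W.IsGloballyMinimal],
      ∃ (W' : WeierstrassCurve ℚ) (q : ℝ), W'.IsElliptic ∧ W'.IsGloballyMinimal ∧
        1 ≤ q ∧ q ≤ c₈ * (W.conductorNorm ℤ : ℝ) ^ 2 ∧
        W'.analyticRank = 0 ∧
        c₂ ≤ (W'.leadingLCoeff).re ∧
        (W'.conductorNorm ℤ : ℝ) ≤ c₁ * q ^ 2 * (W.conductorNorm ℤ : ℝ) ∧
        W'.realPeriodRat ≤ c₇ * q ^ (-(1 / 2) : ℝ) * W.realPeriodRat ∧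
        (W'.minimalDiscriminantNorm ℤ : ℝ) ≤ c₆ * q ^ 6 * (W.minimalDiscriminantNorm ℤ : ℝ)) :
    ∃ C : ℝ, Summit.ABC.PolySzpiroRatEff (12 * (3 / 2 + 5 * ε + 12 * δ) / (1 - 12 * δ)) C ∧
      Summit.ABC.PolySzpiroRat := by
  obtain ⟨c₃, -, hP'⟩ := realPeriodRat_mul_rpow_minimalDiscriminantNorm_le hP
  obtain ⟨c₅, hc₅, hTam⟩ := exists_tamagawaProduct_le_mul_rpow δ hδ
  exact polySzpiroRat_of_goldfeldSzpiroBound_named hε hδ.le hδ' hc₁ hc₂ hc₅ hc₆ hc₇ hc₈ hGS hGZK hC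
    (fun W _ _ => hP' W) (fun W _ _ => hTam W) hT

/-- **G-20, RH(RS wt 3/2) reading, inputs by name** (`q ≤ c₈(α)N^α` for every `α > 0`, GS Thm 2
second clause «`ε′ = 13ε`»): `GoldfeldSzpiroBound` + bsd.S17 + `RankZeroBSDLowerShaBound` + the
Literature fact `realPeriod_mul_rpow_discriminant_le` + (inline) the twist step for every `α` ⟹ the
tree's `SzpiroConjecture` (Szpiro `6+ε`); the `∀ δ` Tamagawa input of p554286 is the theorem
`exists_tamagawaProduct_le_mul_rpow`. abc is not proved by this; conditional as stated.
[cite: GoldfeldSzpiro1995, Thm 2 (p. 75), second clause; proof p. 77] -/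
theorem szpiro_of_goldfeldSzpiroBound_RH_lit
    {c₁ c₂ c₆ c₇ : ℝ} (hc₁ : 0 < c₁) (hc₂ : 0 < c₂) (hc₆ : 0 < c₆) (hc₇ : 0 < c₇)
    (hGS : GoldfeldSzpiroBound)
    (hGZK : rank_eq_analyticRank_of_analyticRank_le_one)
    (hC : RankZeroBSDLowerShaBound)
    (hP : realPeriod_mul_rpow_discriminant_le)
    (hT : ∀ α : ℝ, 0 < α → ∃ c₈ : ℝ, 0 < c₈ ∧
      ∀ (W : WeierstrassCurve ℚ) [W.IsElliptic] [W.IsGloballyMinimal],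
      ∃ (W' : WeierstrassCurve ℚ) (q : ℝ), W'.IsElliptic ∧ W'.IsGloballyMinimal ∧
        1 ≤ q ∧ q ≤ c₈ * (W.conductorNorm ℤ : ℝ) ^ α ∧
        W'.analyticRank = 0 ∧
        c₂ ≤ (W'.leadingLCoeff).re ∧
        (W'.conductorNorm ℤ : ℝ) ≤ c₁ * q ^ 2 * (W.conductorNorm ℤ : ℝ) ∧
        W'.realPeriodRat ≤ c₇ * q ^ (-(1 / 2) : ℝ) * W.realPeriodRat ∧
        (W'.minimalDiscriminantNorm ℤ : ℝ) ≤ c₆ * q ^ 6 * (W.minimalDiscriminantNorm ℤ : ℝ)) :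
    SzpiroConjecture := by
  obtain ⟨c₃, -, hP'⟩ := realPeriodRat_mul_rpow_minimalDiscriminantNorm_le hP
  exact szpiro_of_goldfeldSzpiroBound_RH_named hc₁ hc₂ hc₆ hc₇ hGS hGZK hC (fun W _ _ => hP' W)
    (fun δ hδ => exists_tamagawaProduct_le_mul_rpow δ hδ) hT

end Summit.ABC.Harvest

end
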